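import Literature.Probability.Percolation.IntPairCrossClean
import Literature.Probability.Percolation.IntPairAvoid
import Literature.Probability.Percolation.TrapPairCrossGeom
import HarnessLib

/-!
# The cross-frame inner pair step: the avoidance hypotheses from the position of the inner fences (twin of `TrapPairCrossGeom.lean`)

Topic `Literature/Probability/Percolation`; family `crit-perc` / near-critical percolation on `𝕋`.
A brick of the INNER half of the near-critical arm-separation theorem for four arms in the ADJACENT
colour arrangement (P. Nolin, EJP 13 (2008), Thm. 11, `j = 4`, `σ = BBWW` [arXiv 0711.4948:
Thm. 10], §4.4 Lemma 15 and Thm. 11, internal extremities).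
`IntCrossData.exists_two_clean_routes` (`IntPairCrossClean.lean`) needs, for each structure, a
route avoiding every fence site of the OTHER structure. When the two frames are the rotations
`ρ^{i₁}`, `ρ^{i₂}` (`i₁ ≠ i₂ < 6`), the fence sites of `D₁`, read in the frame of `D₂` through
`ψ = ρ^{i₁ - i₂}`, lie in squares of half-width `2k + 1` about MIDDLE points `(m, t)` of the inner
side `i₁` (`-m + 32k + 1 ≤ t ≤ -(32k + 1)`): through `ρ` their half-annulus sites hang from the
top-type sites of the inner side `1` (`hang_intTp_of_box`), through `ρ⁵` from the bottom-type sites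
of the inner side `5` (`hang_intBt_of_box`), and through `ρ²`, `ρ³`, `ρ⁴` they miss the
half-annulus `haFin m` (`rot_not_mem_haFin_of_box`) — here, unlike in the outer trapezoid, no
midpoint guard is needed. Hence the avoidance hypotheses (`IntCrossData.avoid₂_of_rot`,
`IntCrossData.avoid₁_of_rot`, `swap`) and the cross-frame clean routes
(`IntCrossData.exists_two_clean_routes_of_rot`).

Everything here is proved; no named facts are introduced.

## References

* P. Nolin, Near-critical percolation in two dimensions, *Electron. J. Probab.* 13 (2008), §4.4,
  proof of Lemma 15 and of Thm. 11, internal extremities (arXiv 0711.4948: Lemma 14, Thm. 10) [Nolin2008].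
-/

noncomputable section

open Set

namespace Literature.Probability.Percolation

open LatticeModels HalfAnnulus

open IntPairData (term_isCrossing term_eq tip_isIntJ')

/-! ### Squares about middle points of the inner side, rotated -/

section Box

variable {F : Set (Site 2)} {m k : ℕ} {t : ℤ}

/-- **A connection in a square about the middle point `(m, t)` of the inner side, read through `ρ`,
hangs from the top-type sites** (inner side `1`): if every site of `F` is joined inside `F` to a
site of norm `< m`, then every site of `ρ F` in the half-annulus is joined inside `ρ F ∩ haFin m`
to a site of `(intDom m).Tp`. [folklore] -/
theorem hang_intTp_of_box
    (hbox : ∀ y ∈ F, (m : ℤ) - (2 * k + 1) ≤ y 0 ∧ y 0 ≤ m + (2 * k + 1) ∧ t - (2 * k + 1) ≤ y 1 ∧ y 1 ≤ t + (2 * k + 1))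
    (hconn : ∃ mm ∈ F, triNorm mm < m ∧ ∀ x ∈ F, PathIn triGraph F x mm)
    (hlo : -(m : ℤ) + 4 * k + 4 ≤ t) (hhi : t + 4 * k + 4 ≤ 0) :
    ∀ x ∈ F, triRotIsoPow 1 x ∈ haFin m →
      ∃ x' ∈ (intDom m).Tp, PathIn triGraph (triRotIsoPow 1 '' F ∩ ↑(haFin m)) (triRotIsoPow 1 x) x' := by
  intro x hx hxD
  obtain ⟨mm, hmF, hmn, hpath⟩ := hconn
  have hk : (0 : ℤ) ≤ k := by positivity
  have hp := pathIn_map_iso (triRotIsoPow 1) (hpath x hx)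
  have hmD : triRotIsoPow 1 mm ∉ (↑(haFin m) : Set (Site 2)) := fun h => by
    have h' := (mem_haFin.1 (Finset.mem_coe.1 h)).2.1
    rw [triNorm_triRotIsoPow] at h'
    omega
  obtain ⟨a', b, ha', hbD, hbF, hab, hQ⟩ := hp.exit (R := (↑(haFin m) : Set (Site 2))) (Finset.mem_coe.2 hxD) hmD
  obtain ⟨y, hy, rfl⟩ := hbF
  obtain ⟨y₀, hy₀, hya⟩ : ∃ y₀ ∈ F, triRotIsoPow 1 y₀ = a' := by
    obtain ⟨y₀, hy₀, e⟩ := hQ.right_mem.2; exact ⟨y₀, hy₀, e⟩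
  have hyb := hbox y hy
  have hy₀b := hbox y₀ hy₀
  have hb := triRotIsoPow_one_coord y
  have ha := triRotIsoPow_one_coord y₀
  have ha'D := mem_haFin.1 (Finset.mem_coe.1 ha')
  have hna' : triNorm a' = triNorm y₀ := by rw [← hya, triNorm_triRotIsoPow]
  have hnb : triNorm (triRotIsoPow 1 y) = triNorm y := triNorm_triRotIsoPow 1 y
  have hbD' : ¬ (0 ≤ triRotIsoPow 1 y 0 ∧ (m : ℤ) ≤ triNorm (triRotIsoPow 1 y) ∧ triNorm (triRotIsoPow 1 y) ≤ 2 * m) :=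
    fun h => hbD (Finset.mem_coe.2 (mem_haFin.2 h))
  rw [hb.1, hnb] at hbD'
  have hny : triNorm y < m := by
    have h1 : triNorm y ≤ 2 * m := by rw [triNorm_eq_max]; omega
    by_contra h; exact hbD' ⟨by omega, not_lt.1 h, h1⟩
  -- `a'` has norm `m` (next to the inner site `b`), hence `y₀` is on the tip side: `y₀ 0 = m`
  have hadjn := triNorm_le_triNorm_add_one_of_adj hab.symm
  rw [hnb] at hadjn
  have hna'm : triNorm a' = m := by omega
  have hy₀n : triNorm y₀ = m := by rw [← hna']; exact hna'm
  have hy₀0 : y₀ 0 = m := by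
    have h := hy₀n; rw [triNorm_eq_max] at h; omega
  refine ⟨a', mem_intDom_Tp.2 ⟨Finset.mem_coe.1 ha', ⟨hna'm, Or.inl ⟨?_, ?_⟩⟩⟩, hQ.mono fun v hv => ⟨hv.2, hv.1⟩⟩
  · rw [← hya, ha.2]; omega
  · rw [← hya, ha.1, ha.2]; omega

/-- **A connection in a square about the middle point `(m, t)` of the inner side, read through
`ρ⁵`, hangs from the bottom-type sites** (inner side `5`). [folklore] -/
theorem hang_intBt_of_box
    (hbox : ∀ y ∈ F, (m : ℤ) - (2 * k + 1) ≤ y 0 ∧ y 0 ≤ m + (2 * k + 1) ∧ t - (2 * k + 1) ≤ y 1 ∧ y 1 ≤ t + (2 * k + 1))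
    (hconn : ∃ mm ∈ F, triNorm mm < m ∧ ∀ x ∈ F, PathIn triGraph F x mm)
    (hlo : -(m : ℤ) + 4 * k + 4 ≤ t) (hhi : t + 4 * k + 4 ≤ 0) :
    ∀ x ∈ F, triRotIsoPow 5 x ∈ haFin m →
      ∃ x' ∈ (intDom m).Bt, PathIn triGraph (triRotIsoPow 5 '' F ∩ ↑(haFin m)) (triRotIsoPow 5 x) x' := by
  intro x hx hxD
  obtain ⟨mm, hmF, hmn, hpath⟩ := hconn
  have hk : (0 : ℤ) ≤ k := by positivity
  have hp := pathIn_map_iso (triRotIsoPow 5) (hpath x hx)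
  have hmD : triRotIsoPow 5 mm ∉ (↑(haFin m) : Set (Site 2)) := fun h => by
    have h' := (mem_haFin.1 (Finset.mem_coe.1 h)).2.1
    rw [triNorm_triRotIsoPow] at h'
    omega
  obtain ⟨a', b, ha', hbD, hbF, hab, hQ⟩ := hp.exit (R := (↑(haFin m) : Set (Site 2))) (Finset.mem_coe.2 hxD) hmD
  obtain ⟨y, hy, rfl⟩ := hbF
  obtain ⟨y₀, hy₀, hya⟩ : ∃ y₀ ∈ F, triRotIsoPow 5 y₀ = a' := by
    obtain ⟨y₀, hy₀, e⟩ := hQ.right_mem.2; exact ⟨y₀, hy₀, e⟩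
  have hyb := hbox y hy
  have hy₀b := hbox y₀ hy₀
  have hb := triRotIsoPow_five_coord y
  have ha := triRotIsoPow_five_coord y₀
  have hna' : triNorm a' = triNorm y₀ := by rw [← hya, triNorm_triRotIsoPow]
  have hnb : triNorm (triRotIsoPow 5 y) = triNorm y := triNorm_triRotIsoPow 5 y
  have hbD' : ¬ (0 ≤ triRotIsoPow 5 y 0 ∧ (m : ℤ) ≤ triNorm (triRotIsoPow 5 y) ∧ triNorm (triRotIsoPow 5 y) ≤ 2 * m) :=
    fun h => hbD (Finset.mem_coe.2 (mem_haFin.2 h))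
  rw [hb.1, hnb] at hbD'
  have hny : triNorm y < m := by
    have h1 : triNorm y ≤ 2 * m := by rw [triNorm_eq_max]; omega
    by_contra h; exact hbD' ⟨by omega, not_lt.1 h, h1⟩
  have hadjn := triNorm_le_triNorm_add_one_of_adj hab.symm
  rw [hnb] at hadjn
  have hna'm : triNorm a' = m := by have := (mem_haFin.1 (Finset.mem_coe.1 ha')).2.1; omega
  have hy₀n : triNorm y₀ = m := by rw [← hna']; exact hna'm
  have hy₀0 : y₀ 0 = m := by
    have h := hy₀n; rw [triNorm_eq_max] at h; omega
  refine ⟨a', mem_intDom_Bt.2 ⟨Finset.mem_coe.1 ha', ⟨hna'm, Or.inl ?_⟩⟩, hQ.mono fun v hv => ⟨hv.2, hv.1⟩⟩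
  rw [← hya, ha.2]; omega

/-- **Squares about middle points of the inner side read through `ρ²`, `ρ³`, `ρ⁴` miss the
half-annulus** (they lie in `{v₀ < 0}`). [folklore] -/
theorem rot_not_mem_haFin_of_box
    (hbox : ∀ y ∈ F, (m : ℤ) - (2 * k + 1) ≤ y 0 ∧ y 0 ≤ m + (2 * k + 1) ∧ t - (2 * k + 1) ≤ y 1 ∧ y 1 ≤ t + (2 * k + 1))
    (hlo : -(m : ℤ) + 4 * k + 4 ≤ t) (hhi : t + 4 * k + 4 ≤ 0) {d : ℕ} (hd : d = 2 ∨ d = 3 ∨ d = 4) :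
    ∀ y ∈ F, triRotIsoPow d y ∉ haFin m := by
  intro y hy hyD
  have hyb := hbox y hy
  have hk : (0 : ℤ) ≤ k := by positivity
  have h0 := (mem_haFin.1 hyD).1
  rcases hd with rfl | rfl | rfl
  · rw [(triRotIsoPow_two_coord y).1] at h0; omega
  · rw [(triRotIsoPow_three_coord y).1] at h0; omega
  · rw [(triRotIsoPow_four_coord y).1] at h0; omega

end Box

/-! ### The fence connections of a structure -/

namespace IntPairDataB

variable {m N k₀ K : ℕ}

section Fences

variable {T T' R₀ : ℕ} {χ : SiteConfig (Site 2)} (D : IntPairDataB m N k₀ K T T' R₀ χ)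

/-- The connection of an inner fence from below lies in the square of half-width `2 kOf + 1` about its tip `(m, z₁)`. [folklore] -/
theorem fence_box {u : ℕ} {c : Finset (Site 2)} {z : Site 2} (hu : (intDom m).lowestSeq χ u = some (c, z)) :
    ∀ y ∈ (D.fence hu).F, (m : ℤ) - (2 * D.kOf hu + 1) ≤ y 0 ∧ y 0 ≤ m + (2 * D.kOf hu + 1) ∧
      z 1 - (2 * D.kOf hu + 1) ≤ y 1 ∧ y 1 ≤ z 1 + (2 * D.kOf hu + 1) := fun y hy => by
  have hb := intFenceSet_box ((D.fence hu).F_subset hy)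
  have hz := (tip_isIntJ' hu).1
  omega

/-- The connection of an inner fence from above lies in the square of half-width `2 kOfUp + 1` about its tip. [folklore] -/
theorem fenceUp_box {u : ℕ} {d : Finset (Site 2)} {z : Site 2} (hu : (intDom m).flip.lowestSeq χ u = some (d, z)) :
    ∀ y ∈ (D.fenceUp hu).F, (m : ℤ) - (2 * D.kOfUp hu + 1) ≤ y 0 ∧ y 0 ≤ m + (2 * D.kOfUp hu + 1) ∧
      z 1 - (2 * D.kOfUp hu + 1) ≤ y 1 ∧ y 1 ≤ z 1 + (2 * D.kOfUp hu + 1) := fun y hy => by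
  have hb := intFenceSetUp_box ((D.fenceUp hu).F_subset hy)
  have hz := (tipUp_isIntJ hu).1
  omega

/-- The connection of an inner fence from below is joined inside itself to its fence site inside `Λ_m`. [folklore] -/
theorem fence_conn {u : ℕ} {c : Finset (Site 2)} {z : Site 2} (hu : (intDom m).lowestSeq χ u = some (c, z)) :
    ∃ mm ∈ (D.fence hu).F, triNorm mm < m ∧ ∀ x ∈ (D.fence hu).F, PathIn triGraph (D.fence hu).F x mm :=
  ⟨_, (D.fence hu).m'_mem, D.norm_m' hu, fun _ hx => (D.fence hu).pathIn_to_m' hx⟩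

/-- The connection of an inner fence from above is joined inside itself to its fence site inside `Λ_m`. [folklore] -/
theorem fenceUp_conn {u : ℕ} {d : Finset (Site 2)} {z : Site 2} (hu : (intDom m).flip.lowestSeq χ u = some (d, z)) :
    ∃ mm ∈ (D.fenceUp hu).F, triNorm mm < m ∧ ∀ x ∈ (D.fenceUp hu).F, PathIn triGraph (D.fenceUp hu).F x mm :=
  ⟨_, (D.fenceUp hu).path.right_mem,
    by have := (D.fenceUp hu).norm_m'_succ_le (D.one_le_kOfUp hu) (tipUp_isIntJ hu) (by have := D.tipUp_mid hu; omega); omega,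
    fun _ hx => ((D.fenceUp hu).tight _ hx).symm.trans (D.fenceUp hu).path⟩

/-- **All fence sites of a structure read through `ρ^d` hang from the bottom-type sites** (`d = 5`;
vacuously for `d = 2, 3, 4`). [folklore] -/
theorem FFB_hang_bt {d : ℕ} (hd : d = 5 ∨ d = 2 ∨ d = 3 ∨ d = 4) :
    ∀ x ∈ ⇑(triRotIsoPow d) '' D.FFB, x ∈ haFin m →
      ∃ x' ∈ (intDom m).Bt, PathIn triGraph (⇑(triRotIsoPow d) '' D.FFB ∩ ↑(haFin m)) x x' := by
  rintro x ⟨y, hy, rfl⟩ hxD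
  obtain ⟨F, k, t, hyF, hFsub, hbox, hconn, ⟨hlo, hhi⟩, hk⟩ : ∃ (F : Set (Site 2)) (k : ℕ) (t : ℤ), y ∈ F ∧ F ⊆ D.FFB ∧
      (∀ y ∈ F, (m : ℤ) - (2 * k + 1) ≤ y 0 ∧ y 0 ≤ m + (2 * k + 1) ∧ t - (2 * k + 1) ≤ y 1 ∧ y 1 ≤ t + (2 * k + 1)) ∧
      (∃ mm ∈ F, triNorm mm < m ∧ ∀ x ∈ F, PathIn triGraph F x mm) ∧
      (-(m : ℤ) + 32 * k + 1 ≤ t ∧ t ≤ -(32 * (k : ℤ) + 1)) ∧ 1 ≤ k := by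
    rcases hy with ⟨u, c, z, hu, hyF⟩ | ⟨u, e, z, hu, hyF⟩
    · exact ⟨_, D.kOf hu, z 1, hyF, fun v hv => Or.inl ⟨u, c, z, hu, hv⟩, D.fence_box hu, D.fence_conn hu,
        D.tip_midOf hu, D.one_le_kOf hu⟩
    · exact ⟨_, D.kOfUp hu, z 1, hyF, fun v hv => Or.inr ⟨u, e, z, hu, hv⟩, D.fenceUp_box hu, D.fenceUp_conn hu,
        D.tipUp_mid hu, D.one_le_kOfUp hu⟩
  have hsub : ⇑(triRotIsoPow d) '' F ∩ ↑(haFin m) ⊆ ⇑(triRotIsoPow d) '' D.FFB ∩ ↑(haFin m) :=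
    Set.inter_subset_inter_left _ (Set.image_mono hFsub)
  rcases hd with rfl | hd
  · obtain ⟨x', hx', hP⟩ := hang_intBt_of_box hbox hconn (by omega) (by omega) y hyF hxD
    exact ⟨x', hx', hP.mono hsub⟩
  · exact absurd hxD (rot_not_mem_haFin_of_box hbox (by omega) (by omega) hd y hyF)

/-- **All fence sites of a structure read through `ρ` hang from the top-type sites.** [folklore] -/
theorem FFB_hang_tp :
    ∀ x ∈ ⇑(triRotIsoPow 1) '' D.FFB, x ∈ haFin m →
      ∃ x' ∈ (intDom m).Tp, PathIn triGraph (⇑(triRotIsoPow 1) '' D.FFB ∩ ↑(haFin m)) x x' := by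
  rintro x ⟨y, hy, rfl⟩ hxD
  obtain ⟨F, k, t, hyF, hFsub, hbox, hconn, ⟨hlo, hhi⟩, hk⟩ : ∃ (F : Set (Site 2)) (k : ℕ) (t : ℤ), y ∈ F ∧ F ⊆ D.FFB ∧
      (∀ y ∈ F, (m : ℤ) - (2 * k + 1) ≤ y 0 ∧ y 0 ≤ m + (2 * k + 1) ∧ t - (2 * k + 1) ≤ y 1 ∧ y 1 ≤ t + (2 * k + 1)) ∧
      (∃ mm ∈ F, triNorm mm < m ∧ ∀ x ∈ F, PathIn triGraph F x mm) ∧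
      (-(m : ℤ) + 32 * k + 1 ≤ t ∧ t ≤ -(32 * (k : ℤ) + 1)) ∧ 1 ≤ k := by
    rcases hy with ⟨u, c, z, hu, hyF⟩ | ⟨u, e, z, hu, hyF⟩
    · exact ⟨_, D.kOf hu, z 1, hyF, fun v hv => Or.inl ⟨u, c, z, hu, hv⟩, D.fence_box hu, D.fence_conn hu,
        D.tip_midOf hu, D.one_le_kOf hu⟩
    · exact ⟨_, D.kOfUp hu, z 1, hyF, fun v hv => Or.inr ⟨u, e, z, hu, hv⟩, D.fenceUp_box hu, D.fenceUp_conn hu,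
        D.tipUp_mid hu, D.one_le_kOfUp hu⟩
  have hsub : ⇑(triRotIsoPow 1) '' F ∩ ↑(haFin m) ⊆ ⇑(triRotIsoPow 1) '' D.FFB ∩ ↑(haFin m) :=
    Set.inter_subset_inter_left _ (Set.image_mono hFsub)
  obtain ⟨x', hx', hP⟩ := hang_intTp_of_box hbox hconn (by omega) (by omega) y hyF hxD
  exact ⟨x', hx', hP.mono hsub⟩

end Fences

end IntPairDataB

/-! ### The avoidance hypotheses for rotated frames -/

namespace IntCrossData

variable {m N k₀ K T₁ T₁' T₂ T₂' R₀ : ℕ} {χ₁ χ₂ : SiteConfig (Site 2)} (X : IntCrossData m N k₀ K T₁ T₁' T₂ T₂' R₀ χ₁ χ₂)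

/-- **The avoidance hypothesis for `D₂` when the frames are rotations** `φ₁ = ρ^{i₁}`,
`φ₂ = ρ^{i₂}` (`i₁ ≠ i₂ < 6`). [cite: Nolin2008, §4.4 Lemma 15 (proof), internal extremities (arXiv 0711.4948: Lemma 14)] -/
theorem avoid₂_of_rot {i₁ i₂ : ℕ} (hi₁ : i₁ < 6) (hi₂ : i₂ < 6) (hne : i₁ ≠ i₂)
    (hφ₁ : ∀ u, X.φ₁ u = triRotIsoPow i₁ u) (hφ₂ : ∀ u, X.φ₂ u = triRotIsoPow i₂ u) :
    ∃ (i : Fin 2) (S : Set (Site 2)) (t : Site 2), t ∈ X.D₂.FFB ∧ PathIn triGraph S (X.D₂.b i) t ∧ S ⊆ X.D₂.AsetB ∧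
      ∀ x ∈ S, X.φ₂ x ∉ X.FF𝔉₁ := by
  set d := (i₁ + (6 - i₂)) % 6 with hdd
  have hψ : ∀ u, X.φ₂.symm (X.φ₁ u) = triRotIsoPow d u := fun u => by
    rw [X.φ₂.symm_apply_eq, hφ₁, hφ₂, ← RelIso.symm_apply_eq, triRotIsoPow_symm_comp_apply hi₂.le]
  set Xs : Set (Site 2) := ⇑(triRotIsoPow d) '' X.D₁.FFB with hXs
  have hXarm : ∀ x ∈ Xs, x ∉ X.D₂.armSet := by
    rintro x ⟨y, hy, rfl⟩ hx
    rw [← hψ] at hx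
    exact X.D₁.not_mem_FFB_of_mem_armSet ((X.armSet_corr).2 hx) hy
  have hXF : ∀ x ∈ Xs, x ∉ X.D₂.FFB := by
    rintro x ⟨y, hy, rfl⟩ hx
    rw [← hψ] at hx
    exact X.fence_far y _ hy hx (by rw [RelIso.apply_symm_apply])
  have hd : d = 1 ∨ (d = 5 ∨ d = 2 ∨ d = 3 ∨ d = 4) := by omega
  have concl : ∀ {i : Fin 2} {S : Set (Site 2)} {t : Site 2}, t ∈ X.D₂.FFB → PathIn triGraph S (X.D₂.b i) t →
      S ⊆ X.D₂.AsetB → Disjoint S Xs →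
      ∃ (i : Fin 2) (S : Set (Site 2)) (t : Site 2), t ∈ X.D₂.FFB ∧ PathIn triGraph S (X.D₂.b i) t ∧ S ⊆ X.D₂.AsetB ∧
        ∀ x ∈ S, X.φ₂ x ∉ X.FF𝔉₁ := by
    intro i S t ht hP hSA hdisj
    refine ⟨i, S, t, ht, hP, hSA, fun x hx => ?_⟩
    rintro ⟨y, hy, he⟩
    have hxy : x = triRotIsoPow d y := by rw [← hψ, RelIso.eq_symm_apply, he]
    exact Set.disjoint_left.1 hdisj hx ⟨y, hy, hxy.symm⟩
  rcases hd with hd1 | hd'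
  · obtain ⟨c₂, z₂, hu₂, -⟩ := X.D₂.uMin_spec
    have hX : ∀ x ∈ Xs, x ∈ haFin m → ∃ x' ∈ (intDom m).Tp, PathIn triGraph (Xs ∩ ↑(haFin m)) x x' := by
      rw [hXs, hd1]; exact X.D₁.FFB_hang_tp
    obtain ⟨i, S, hP, hSA, hm, hdisj⟩ := X.D₂.route_c_avoid hu₂ hXarm hX fun x hx hxF => hXF x hx (Or.inl ⟨_, c₂, z₂, hu₂, hxF⟩)
    exact concl (Or.inl ⟨_, c₂, z₂, hu₂, hm⟩) hP hSA hdisj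
  · obtain ⟨d₂, z₂, hu₂, -⟩ := X.D₂.uMinUp_spec
    have hX : ∀ x ∈ Xs, x ∈ haFin m → ∃ x' ∈ (intDom m).Bt, PathIn triGraph (Xs ∩ ↑(haFin m)) x x' := by
      rw [hXs]; exact X.D₁.FFB_hang_bt hd'
    obtain ⟨i, S, hP, hSA, hm, hdisj⟩ := X.D₂.route_d_avoid hu₂ hXarm hX fun x hx hxF => hXF x hx (Or.inr ⟨_, d₂, z₂, hu₂, hxF⟩)
    exact concl (Or.inr ⟨_, d₂, z₂, hu₂, hm⟩) hP hSA hdisj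

/-- **Swapping the two structures.** [folklore] -/
def swap : IntCrossData m N k₀ K T₂ T₂' T₁ T₁' R₀ χ₂ χ₁ where
  D₁ := X.D₂
  D₂ := X.D₁
  φ₁ := X.φ₂
  φ₂ := X.φ₁
  arm0 v := by
    have h := X.arm1 (X.φ₁.symm (X.φ₂ v))
    rw [RelIso.apply_symm_apply, RelIso.symm_apply_apply] at h
    exact h.symm
  arm1 v := by
    have h := X.arm0 (X.φ₁.symm (X.φ₂ v))
    rw [RelIso.apply_symm_apply, RelIso.symm_apply_apply] at h
    exact h.symm
  start0 := X.start1.symm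
  start1 := X.start0.symm
  fence_far x y hx hy h := X.fence_far y x hy hx h.symm

/-- The actual fence sites of `D₁` of the swapped data are those of `D₂`. [folklore] -/
@[simp] theorem swap_FF𝔉₁ (X : IntCrossData m N k₀ K T₁ T₁' T₂ T₂' R₀ χ₁ χ₂) : X.swap.FF𝔉₁ = X.FF𝔉₂ := rfl

/-- The actual fence sites of `D₂` of the swapped data are those of `D₁`. [folklore] -/
@[simp] theorem swap_FF𝔉₂ (X : IntCrossData m N k₀ K T₁ T₁' T₂ T₂' R₀ χ₁ χ₂) : X.swap.FF𝔉₂ = X.FF𝔉₁ := rfl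

/-- **The avoidance hypothesis for `D₁` when the frames are rotations** (by swapping). [cite: Nolin2008, §4.4 Lemma 15 (proof), internal extremities (arXiv 0711.4948: Lemma 14)] -/
theorem avoid₁_of_rot {i₁ i₂ : ℕ} (hi₁ : i₁ < 6) (hi₂ : i₂ < 6) (hne : i₁ ≠ i₂)
    (hφ₁ : ∀ u, X.φ₁ u = triRotIsoPow i₁ u) (hφ₂ : ∀ u, X.φ₂ u = triRotIsoPow i₂ u) :
    ∃ (i : Fin 2) (S : Set (Site 2)) (t : Site 2), t ∈ X.D₁.FFB ∧ PathIn triGraph S (X.D₁.b i) t ∧ S ⊆ X.D₁.AsetB ∧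
      ∀ x ∈ S, X.φ₁ x ∉ X.FF𝔉₂ :=
  X.swap.avoid₂_of_rot hi₂ hi₁ hne.symm hφ₂ hφ₁

/-- **Two vertex-disjoint clean routes exiting through inner fences of different sides, for rotated
frames** `φ₁ = ρ^{i₁}`, `φ₂ = ρ^{i₂}` (`i₁ ≠ i₂ < 6`). [cite: Nolin2008, §4.4 Lemma 15 (proof), internal extremities (arXiv 0711.4948: Lemma 14, last paragraph)] [cite: Diestel2017, Thm. 3.3.1 and §1.7] -/
theorem exists_two_clean_routes_of_rot {i₁ i₂ : ℕ} (hi₁ : i₁ < 6) (hi₂ : i₂ < 6) (hne : i₁ ≠ i₂)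
    (hφ₁ : ∀ u, X.φ₁ u = triRotIsoPow i₁ u) (hφ₂ : ∀ u, X.φ₂ u = triRotIsoPow i₂ u) :
    ∃ (e₀ e₁ : X.ExitRef) (S₀ S₁ : Set (Site 2)), e₀.side ≠ e₁.side ∧
      PathIn triGraph S₀ (X.φ₁ (X.D₁.b 0)) e₀.m𝔄 ∧ PathIn triGraph S₁ (X.φ₁ (X.D₁.b 1)) e₁.m𝔄 ∧
      e₀.m𝔄 ∈ e₀.F𝔄 ∧ e₁.m𝔄 ∈ e₁.F𝔄 ∧ S₀ ⊆ X.B𝔅 ∪ e₀.F𝔄 ∧ S₁ ⊆ X.B𝔅 ∪ e₁.F𝔄 ∧ Disjoint S₀ S₁ :=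
  X.exists_two_clean_routes (X.avoid₁_of_rot hi₁ hi₂ hne hφ₁ hφ₂) (X.avoid₂_of_rot hi₁ hi₂ hne hφ₁ hφ₂)

end IntCrossData

end Literature.Probability.Percolation
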